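import Summits.Langlands.Langlands.Theses.DyadicOddResidue
import Literature.NumberTheory.Automorphic.CompletedCohomologyHeckeAlgebraGLn
import Literature.NumberTheory.Automorphic.FontaineMazurGL2OddPrime
import Literature.NumberTheory.GaloisRepresentations.OrdinaryTwistedDeterminant
import Literature.NumberTheory.Automorphic.ProModularDeRhamClassicalGL2Q
import Literature.NumberTheory.Automorphic.FontaineMazurGL2PotCrystallineOrdinary
import Literature.NumberTheory.Automorphic.FontaineMazurGL2DyadicNearlyOrdinaryDihedral
import Summits.Langlands.Langlands.Theorems.DyadicOddResidueDyadicDihedralFMDictionary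
import Summits.Langlands.Langlands.Theorems.DyadicOddResidueDyadicDihedralFMClassicality

/-!
# Line `Sketch` for the crux `DyadicOddResidue.DyadicDihedralFM` (stmt-Langlands-18742) — LEAD'S SKELETON, rev 3
(prover-line-stmt-Langlands-18742-0, lineage 0, gen 1, 2026-08-17)

Source line: crux-ideate round 1 ideator 2, evidence `20260817T054621Z-Sketch.lean` (rc 0, 0 sorries: the two
halves `DyadicProModularity`, `DyadicClassicality` typed as Props and `dyadicDihedralFM_of` composing them to the
route decl by name), cards `Ideas/dyadic-fern-propagation.md` (the line: 2-adic infinite fern seeded at weight 2 ⇒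
big `R^odd = 𝕋` ⇒ pro-modularity ⇒ Pan II classicality at `p = 2`) and `Ideas/supersingular-depth-lifting.md` (its
weight-2 non-ordinary seed).  The evidence file is not mounted in a prover jail; this file RE-TYPES the same
composition with registered `stub_*` sorries, cutting the classicality half at the seam the literature uses:

* `stub_proModularity` (LEAD; the OPEN CORE, = the card's C⁺ / stubs F1–F3): every odd, residually dihedral
  (absolutely irreducible with solvable image), de Rham regular 2-adic `ρ` of `Γ_ℚ` is 2-adically automorphic of
  some tame level — a continuous `ℚ̄₂`-point of the tree's completed-cohomology Hecke algebra
  (`BigHeckeGLn.TameLevel.IsPadicallyAutomorphic`, the rendering of "pro-modular" used by the accepted route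
  statements `SkinnerWilesDefectOne.ProModularOrdinaryClassical` / `EisensteinGelfandKirillov.CrystallineProModularClassical`).
* `stub_classicality` (worker; PRINTED modulo glue): pro-modular + residually absolutely irreducible + de Rham with
  distinct Hodge–Tate weights at 2 ⇒ some Tate twist `ρ ⊗ ε₂^m` is the Galois representation of a newform
  (classical rendering of the tree, `IsGaloisRepOfNewform1`, as in `XZhang2024_fontaineMazurGL2_tateTwist`).
  Source: Pan, arXiv:2209.06366 Thm 1.1.2 = Thm 7.1.2 ("Fix a prime number p"; (1) `Hom_{E[G_ℚ]}(ρ, H̃¹(K^p,E)) ≠ 0`,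
  (2) de Rham of HT weights `0, k`, `k > 0` ⇒ `ρ` arises from a cuspidal eigenform of weight `k + 1`), plus the
  occupancy glue "continuous point of `𝕋(K^p)_𝔪`, `𝔪` non-Eisenstein ⇒ `ρ` appears in `H̃¹(K^p,E)`" and the Tate
  twist moving HT `{a,b}` to `{0,b-a}`.
* `stub_dictionary` (worker; PROVABLE NOW): Tate-twist newform modularity ⇒ the crux's conclusion (an `L`-algebraic
  cuspidal `π` of `GL₂(𝔸_ℚ)` Satake–Frobenius compatible with `ρ` a.e.), for EVERY prime `ℓ` — the argument of
  `Summit.Langlands.Langlands.Theorems.oddPrimesRegularFM_of_tateTwistModularity` (which never uses `ℓ` odd).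

Composition (pure logic): `DyadicDihedralFM_of : DyadicDihedralFM` from the stubs.

**Rev 2 (after wave 1, 2026-08-17).** `stub_dictionary` LANDED (p145281,
`Theorems/DyadicOddResidueDyadicDihedralFMDictionary.lean`) and is imported.  The classicality worker vendored Pan II
as the named fact `Literature.NumberTheory.Automorphic.Pan2022_proModularDeRhamClassical_GL2Q` (p145835, ACCEPTED;
stated for EVERY prime with literally the old stub's hypotheses/conclusion; glue (a) "pro-modular and irreducible ⇒
appears in `H̃¹`" is Pan, Forum Math. Pi 10 (2022) Cor. 6.3.6, unconditional in `p` by Paškūnas–Tung 2021 Thm 7.1)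
and replied `stub-blocked` on it.  RESHAPE: the fact becomes its own registered stub `stub_Pan2022` (the line's
declared trust base = one XL printed theorem, to be discharged by a literature seat, never here), and
`stub_classicality` is re-registered CURRIED over it (`fact → classicality at 2`, a one-line specialisation) and
LANDED (p148844, `Theorems/DyadicOddResidueDyadicDihedralFMClassicality.lean`, imported).  Open after rev 2:
`stub_proModularity` (OPEN CORE, lead) and `stub_Pan2022` (printed, XL: the line's trust base).

**Rev 3 (cycle 1, after the lead's census of `stub_proModularity`).** The two PRINTED sub-cells of the crux are carved
out of the open core and closed through `stub_dictionary`, each conditionally on a named fact vendored by the lead and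
ACCEPTED into Literature this cycle:
* `stub_Thorne2026` = `Literature.NumberTheory.Automorphic.Thorne2026_fontaineMazurGL2_potCrystallineOrdinary`
  (p149703; Thorne arXiv:2608.07186 Thm D, 7 Aug 2026: ANY prime, ANY residual image, `ρ|G_ℚp` potentially
  crystalline and ordinary of HT `{0,1}` ⇒ modular; Tate twist folded in, classical rendering) — closes the cell
  `CellThorne` (some Tate twist of `ρ` is Skinner–Wiles-ordinary of weight 2 and potentially crystalline at 2);
* `stub_Allen2014` = `Literature.NumberTheory.Automorphic.Allen2014_modularity_nearlyOrdinaryDihedral_Q` (p150207;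
  Allen, Compositio 150 (2014), Theorem, `F = ℚ`: nearly ordinary at 2 + residually abs. irreducible solvable +
  condition (5) ⇒ modular) — closes the cell `CellAllen` (Allen's (5), typed by the accepted `AllenConditionFive`,
  and some Tate twist Skinner–Wiles-ordinary of a weight `k ≥ 2` with `det · ε^{1−k}` of finite order).
The cell implications `cellThorne_newform`, `cellAllen_newform` are one-line specialisations proved IN this file.
The registered open core is now `stub_proModularity_core`: the old `stub_proModularity` at the literal prime `2`
with the two extra hypotheses `¬ CellThorne`, `¬ CellAllen` (spelled out) — i.e. 2-adic pro-modularity is demanded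
only OFF the printed cells: `ρ|G_ℚ₂` with no Tate twist that is pot.-crystalline SW-ordinary of weight 2, and
(Allen's (5) failing or no Tate twist nearly ordinary of weight ≥ 2 with finite-order `det·ε^{1-k}`).  On paper this
is: `ρ|G_ℚ₂` irreducible (the supersingular dihedral block, any weights), or `ρ|G_ℚ₂` reducible with residual
quadratic field imaginary and 2 split in it, outside the pot.-crystalline consecutive-weight case.  NOT IN PRINT.
Sorries after rev 3: `stub_proModularity_core` (OPEN), `stub_Pan2022`, `stub_Thorne2026`, `stub_Allen2014` (three
XL printed named facts = the line's trust base).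

**Disproof used (rev 1–3):** none exists yet (`payload.disproof_path` absent; `ledger crux ls`: no `Disproof.lean`).
Refuter's crux-attack (CruxAttack.lean, 2026-08-17T04:58Z): S→C and target→C certified, hypotheses satisfiable
(`ρ = V₂(X₀(11)) ⊗ ℚ̄₂`, supersingular at 2), so no stub strengthens the crux's hypotheses: `stub_proModularity`
carries them verbatim, `stub_classicality`/`stub_dictionary` drop the ones their sources do not need (stronger stubs).
-/

namespace Summit.Langlands.Langlands.Cruxes.DyadicDihedralFM.Sketch

set_option linter.dupNamespace false
set_option linter.unusedVariables false

open scoped MatrixGroups ModularForm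
open CongruenceSubgroup
open Summit.Langlands.Langlands.Theses.DyadicOddResidue

noncomputable section

/-! ## 1. The registered stubs (the ONLY `sorry`s of the file; each a closed one-line statement). -/

/-! ### The two printed cells (rev 3) -/

/-- **Cell of Thorne 2026 Thm D** at the prime `ℓ`: some Tate twist `ρ ⊗ ε^a` is, at the place above `ℓ`,
Skinner–Wiles-ordinary of weight `2` (exponent `m > 0`), de Rham for the pinned Fontaine datum, and potentially
crystalline (`N = 0` on every attached Weil–Deligne representation) — VERBATIM the twist-hypothesis of the named
fact `Thorne2026_fontaineMazurGL2_potCrystallineOrdinary` at `p = ℓ`. -/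
def CellThorne (ℓ : ℕ) [Fact ℓ.Prime]
    (ρ : Literature.NumberTheory.GaloisRepresentations.FramedGaloisRep ℚ (PadicAlgCl ℓ) 2) : Prop :=
  ∃ (χ₀ : Field.absoluteGaloisGroup ℚ →ₜ* (PadicAlgCl ℓ)ˣ) (a : ℤ) (m : ℕ),
    (∀ σ, χ₀ σ = Literature.NumberTheory.GaloisRepresentations.cyclotomicPadicAlgCl ℚ ℓ σ ^ a) ∧ 0 < m ∧
    ∀ (v : IsDedekindDomain.HeightOneSpectrum (NumberField.RingOfIntegers ℚ))
      (hv : ((ℓ : ℕ) : NumberField.RingOfIntegers ℚ) ∈ v.asIdeal),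
      Literature.NumberTheory.GaloisRepresentations.FramedGaloisRep.IsOrdinaryOfWeightAt ℓ
          (Literature.NumberTheory.GaloisRepresentations.FramedRep.twist ρ χ₀) v 2 m ∧
      (Literature.NumberTheory.PAdicHodge.fontainePstAdicCompletion v ℓ hv).IsDeRhamFramed
          (Literature.NumberTheory.GaloisRepresentations.FramedGaloisRep.toLocal v
            (Literature.NumberTheory.GaloisRepresentations.FramedRep.twist ρ χ₀)) ∧
      ∀ r, (Literature.NumberTheory.PAdicHodge.fontainePstAdicCompletion v ℓ hv).IsWeilDeligneOf
          (Literature.NumberTheory.GaloisRepresentations.FramedGaloisRep.toLocal v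
            (Literature.NumberTheory.GaloisRepresentations.FramedRep.twist ρ χ₀)) r → r.N = 0

/-- **Cell of Allen 2014** (at the prime `2`): Allen's condition (5) on the residual representation (accepted
`AllenConditionFive`) and some Tate twist `ρ ⊗ ε₂^a` Skinner–Wiles-ordinary of a weight `k ≥ 2` at the place above
`2` with `det(ρ ⊗ ε₂^a) · ε₂^{1−k}` of finite order — VERBATIM hypotheses (5), (2)+(1) of the named fact
`Allen2014_modularity_nearlyOrdinaryDihedral_Q`. -/
def CellAllen (ρ : Literature.NumberTheory.GaloisRepresentations.FramedGaloisRep ℚ (PadicAlgCl 2) 2) : Prop :=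
  Literature.NumberTheory.GaloisRepresentations.AllenConditionFive ρ.residualRep ∧
  ∃ (χ₀ : Field.absoluteGaloisGroup ℚ →ₜ* (PadicAlgCl 2)ˣ) (a : ℤ) (k m : ℕ),
    (∀ σ, χ₀ σ = Literature.NumberTheory.GaloisRepresentations.cyclotomicPadicAlgCl ℚ 2 σ ^ a) ∧ 2 ≤ k ∧ 0 < m ∧
    (∀ v : IsDedekindDomain.HeightOneSpectrum (NumberField.RingOfIntegers ℚ),
      ((2 : ℕ) : NumberField.RingOfIntegers ℚ) ∈ v.asIdeal →
      Literature.NumberTheory.GaloisRepresentations.FramedGaloisRep.IsOrdinaryOfWeightAt 2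
        (Literature.NumberTheory.GaloisRepresentations.FramedRep.twist ρ χ₀) v k m) ∧
    ∃ n : ℕ, 0 < n ∧ ∀ σ,
      (Literature.NumberTheory.GaloisRepresentations.FramedRep.det
          (Literature.NumberTheory.GaloisRepresentations.FramedRep.twist ρ χ₀) σ *
        (Literature.NumberTheory.GaloisRepresentations.cyclotomicPadicAlgCl ℚ 2 σ ^ ((k : ℤ) - 1))⁻¹) ^ n = 1

/-- **Stub — trust base: Thorne 2026 Thm D** (named fact `Thorne2026_fontaineMazurGL2_potCrystallineOrdinary`,
p149703, vendored by the lead this cycle).  XL printed theorem; a literature debt, not this line's work. -/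
theorem stub_Thorne2026 : Literature.NumberTheory.Automorphic.Thorne2026_fontaineMazurGL2_potCrystallineOrdinary := by
  sorry

/-- **Stub — trust base: Allen 2014 Theorem (F = ℚ)** (named fact `Allen2014_modularity_nearlyOrdinaryDihedral_Q`,
p150207, vendored by the lead this cycle).  XL printed theorem; a literature debt, not this line's work. -/
theorem stub_Allen2014 : Literature.NumberTheory.Automorphic.Allen2014_modularity_nearlyOrdinaryDihedral_Q := by
  sorry

/-- The Thorne cell is closed by the fact: Tate-twist newform modularity for `ρ` (one-line specialisation). -/
theorem cellThorne_newform (hT : Literature.NumberTheory.Automorphic.Thorne2026_fontaineMazurGL2_potCrystallineOrdinary)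
    (ℓ : ℕ) [Fact ℓ.Prime] (ρ : Literature.NumberTheory.GaloisRepresentations.FramedGaloisRep ℚ (PadicAlgCl ℓ) 2)
    (hunr : ∀ᶠ v : IsDedekindDomain.HeightOneSpectrum (NumberField.RingOfIntegers ℚ) in Filter.cofinite,
      ρ.IsUnramifiedAt v)
    (hirr : ρ.toGaloisRep.IsIrreducible) (hodd : ρ.IsOdd) (hB : CellThorne ℓ ρ) :
    ∃ (χ : Field.absoluteGaloisGroup ℚ →ₜ* (PadicAlgCl ℓ)ˣ) (m : ℤ),
      (∀ σ, χ σ = Literature.NumberTheory.GaloisRepresentations.cyclotomicPadicAlgCl ℚ ℓ σ ^ m) ∧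
      ∃ (N : ℕ) (_ : NeZero N) (k : ℤ) (f : CuspForm (CongruenceSubgroup.Gamma1 N) k)
        (ιf : Literature.NumberTheory.EllipticCurves.ModularForms.coeffCharField f →+* PadicAlgCl ℓ),
        Literature.NumberTheory.EllipticCurves.ModularForms.IsNewform1 f ∧
        Literature.NumberTheory.EllipticCurves.ModularForms.IsGaloisRepOfNewform1 f ιf {q | q ∣ N * ℓ}
          (Literature.NumberTheory.GaloisRepresentations.FramedRep.twist ρ χ) :=
  hT ℓ ρ hunr hirr hodd hB

/-- The Allen cell is closed by the fact: Tate-twist newform modularity for `ρ` (one-line specialisation). -/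
theorem cellAllen_newform (hA' : Literature.NumberTheory.Automorphic.Allen2014_modularity_nearlyOrdinaryDihedral_Q)
    (ρ : Literature.NumberTheory.GaloisRepresentations.FramedGaloisRep ℚ (PadicAlgCl 2) 2)
    (hunr : ∀ᶠ v : IsDedekindDomain.HeightOneSpectrum (NumberField.RingOfIntegers ℚ) in Filter.cofinite,
      ρ.IsUnramifiedAt v)
    (hodd : ρ.IsOdd) (hres : ρ.IsResiduallyAbsIrreducible) (hsol : IsSolvable ρ.residualRep.range)
    (hA : CellAllen ρ) :
    ∃ (χ : Field.absoluteGaloisGroup ℚ →ₜ* (PadicAlgCl 2)ˣ) (m : ℤ),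
      (∀ σ, χ σ = Literature.NumberTheory.GaloisRepresentations.cyclotomicPadicAlgCl ℚ 2 σ ^ m) ∧
      ∃ (N : ℕ) (_ : NeZero N) (k : ℤ) (f : CuspForm (CongruenceSubgroup.Gamma1 N) k)
        (ιf : Literature.NumberTheory.EllipticCurves.ModularForms.coeffCharField f →+* PadicAlgCl 2),
        Literature.NumberTheory.EllipticCurves.ModularForms.IsNewform1 f ∧
        Literature.NumberTheory.EllipticCurves.ModularForms.IsGaloisRepOfNewform1 f ιf {q | q ∣ N * 2}
          (Literature.NumberTheory.GaloisRepresentations.FramedRep.twist ρ χ) :=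
  hA' ρ hunr hodd hres hsol hA.1 hA.2

/-! ### The open core (rev 3) -/

/-- **Stub (lead) — OPEN CORE (rev 3): 2-adic pro-modularity OFF the two printed cells.**  Hypotheses = the crux's at
the literal prime `2`, verbatim, PLUS `¬ CellThorne 2 ρ` and `¬ CellAllen ρ` spelled out (no Tate twist of `ρ` is
potentially crystalline Skinner–Wiles-ordinary of weight 2 at 2; and Allen's cell fails: condition (5) false, or no
Tate twist nearly ordinary of weight `≥ 2` with finite-order `det·ε^{1−k}`); conclusion = `ρ` is a continuous
`ℚ̄₂`-point of the completed-cohomology Hecke algebra of `GL₂/ℚ` of some tame level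
(`TameLevel.IsPadicallyAutomorphic`).  Card F1–F3 (infinite fern at `p = 2` seeded at weight 2).  NOT IN PRINT:
on paper the domain is `ρ|G_ℚ₂` irreducible (supersingular dihedral block, all weights) ∪ (`ρ|G_ℚ₂` reducible,
residual quadratic field imaginary with 2 split, outside pot.-crystalline consecutive weights). -/
theorem stub_proModularity_core : ∀ (ρ : Literature.NumberTheory.GaloisRepresentations.FramedGaloisRep ℚ (PadicAlgCl 2) 2), ρ.IsResiduallyAbsIrreducible → IsSolvable ρ.residualRep.range → ρ.toGaloisRep.IsIrreducible → ρ.IsOdd → (∀ᶠ v : IsDedekindDomain.HeightOneSpectrum (NumberField.RingOfIntegers ℚ) in Filter.cofinite, ρ.IsUnramifiedAt v) → (∀ (v : IsDedekindDomain.HeightOneSpectrum (NumberField.RingOfIntegers ℚ)) (hv : ((2 : ℕ) : NumberField.RingOfIntegers ℚ) ∈ v.asIdeal), (Literature.NumberTheory.PAdicHodge.fontainePstAdicCompletion v 2 hv).IsDeRhamFramed (ρ.toLocal v) ∧ ∀ τ : v.adicCompletion ℚ →+* PadicAlgCl 2, Continuous τ → (ρ.labelledHodgeTateWeightsAt v (Literature.NumberTheory.PAdicHodge.fontainePstAdicCompletion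 v 2 hv).algebra (Literature.NumberTheory.PAdicHodge.fontainePstAdicCompletion v 2 hv).𝔅 τ).Nodup) → ¬ (∃ (χ₀ : Field.absoluteGaloisGroup ℚ →ₜ* (PadicAlgCl 2)ˣ) (a : ℤ) (m : ℕ), (∀ σ, χ₀ σ = Literature.NumberTheory.GaloisRepresentations.cyclotomicPadicAlgCl ℚ 2 σ ^ a) ∧ 0 < m ∧ ∀ (v : IsDedekindDomain.HeightOneSpectrum (NumberField.RingOfIntegers ℚ)) (hv : ((2 : ℕ) : NumberField.RingOfIntegers ℚ) ∈ v.asIdeal), Literature.NumberTheory.GaloisRepresentations.FramedGaloisRep.IsOrdinaryOfWeightAt 2 (Literature.NumberTheory.GaloisRepresentations.FramedRep.twist ρ χ₀) v 2 m ∧ (Literature.NumberTheory.PAdicHodge.fontainePstAdicCompletion v 2 hv).IsDeRhamFramed (Literature.NumberTheory.GaloisRepresentations.FramedGaloisRep.toLocal v (Literature.NumberTheory.GaloisRepresentations.FramedRep.twist ρ χ₀)) ∧ ∀ r, (Literature.NumberTheory.PAdicHodge.fontainePstAdicCompletion v 2 hv).IsWeilDeligneOf (Literature.NumberTheory.GaloisRepresentations.FramedGaloisRep.toLocal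 v (Literature.NumberTheory.GaloisRepresentations.FramedRep.twist ρ χ₀)) r → r.N = 0) → ¬ (Literature.NumberTheory.GaloisRepresentations.AllenConditionFive ρ.residualRep ∧ ∃ (χ₀ : Field.absoluteGaloisGroup ℚ →ₜ* (PadicAlgCl 2)ˣ) (a : ℤ) (k m : ℕ), (∀ σ, χ₀ σ = Literature.NumberTheory.GaloisRepresentations.cyclotomicPadicAlgCl ℚ 2 σ ^ a) ∧ 2 ≤ k ∧ 0 < m ∧ (∀ v : IsDedekindDomain.HeightOneSpectrum (NumberField.RingOfIntegers ℚ), ((2 : ℕ) : NumberField.RingOfIntegers ℚ) ∈ v.asIdeal → Literature.NumberTheory.GaloisRepresentations.FramedGaloisRep.IsOrdinaryOfWeightAt 2 (Literature.NumberTheory.GaloisRepresentations.FramedRep.twist ρ χ₀) v k m) ∧ ∃ n : ℕ, 0 < n ∧ ∀ σ, (Literature.NumberTheory.GaloisRepresentations.FramedRep.det (Literature.NumberTheory.GaloisRepresentations.FramedRep.twist ρ χ₀) σ * (Literature.NumberTheory.GaloisRepresentations.cyclotomicPadicAlgCl ℚ 2 σ ^ ((k : ℤ) - 1))⁻¹)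 ^ n = 1) → ∃ 𝒰 : Literature.NumberTheory.Automorphic.BigHeckeGLn.TameLevel 2 ℚ 2, 𝒰.IsPadicallyAutomorphic ρ := by
  sorry

/-- Read-back: the rev-1/2 stub (`stub_proModularity`, full strength, every crux-`ρ`) implies the rev-3 core. -/
theorem stub_proModularity_core_of_full
    (h : ∀ (ℓ : ℕ) [Fact ℓ.Prime], ℓ = 2 → ∀ (ρ : Literature.NumberTheory.GaloisRepresentations.FramedGaloisRep ℚ (PadicAlgCl ℓ) 2), ρ.IsResiduallyAbsIrreducible → IsSolvable ρ.residualRep.range → ρ.toGaloisRep.IsIrreducible → ρ.IsOdd → (∀ᶠ v : IsDedekindDomain.HeightOneSpectrum (NumberField.RingOfIntegers ℚ) in Filter.cofinite, ρ.IsUnramifiedAt v) → (∀ (v : IsDedekindDomain.HeightOneSpectrum (NumberField.RingOfIntegers ℚ)) (hv : ((ℓ : ℕ) : NumberField.RingOfIntegers ℚ) ∈ v.asIdeal), (Literature.NumberTheory.PAdicHodge.fontainePstAdicCompletion v ℓ hv).IsDeRhamFramed (ρ.toLocal v) ∧ ∀ τ : v.adicCompletion ℚ →+* PadicAlgCl ℓ,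 Continuous τ → (ρ.labelledHodgeTateWeightsAt v (Literature.NumberTheory.PAdicHodge.fontainePstAdicCompletion v ℓ hv).algebra (Literature.NumberTheory.PAdicHodge.fontainePstAdicCompletion v ℓ hv).𝔅 τ).Nodup) → ∃ 𝒰 : Literature.NumberTheory.Automorphic.BigHeckeGLn.TameLevel 2 ℚ ℓ, 𝒰.IsPadicallyAutomorphic ρ)
    (ρ : Literature.NumberTheory.GaloisRepresentations.FramedGaloisRep ℚ (PadicAlgCl 2) 2)
    (hres : ρ.IsResiduallyAbsIrreducible) (hsol : IsSolvable ρ.residualRep.range)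
    (hirr : ρ.toGaloisRep.IsIrreducible) (hodd : ρ.IsOdd)
    (hunr : ∀ᶠ v : IsDedekindDomain.HeightOneSpectrum (NumberField.RingOfIntegers ℚ) in Filter.cofinite,
      ρ.IsUnramifiedAt v)
    (hdR : ∀ (v : IsDedekindDomain.HeightOneSpectrum (NumberField.RingOfIntegers ℚ))
      (hv : ((2 : ℕ) : NumberField.RingOfIntegers ℚ) ∈ v.asIdeal),
      (Literature.NumberTheory.PAdicHodge.fontainePstAdicCompletion v 2 hv).IsDeRhamFramed (ρ.toLocal v) ∧
      ∀ τ : v.adicCompletion ℚ →+* PadicAlgCl 2, Continuous τ →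
        (ρ.labelledHodgeTateWeightsAt v (Literature.NumberTheory.PAdicHodge.fontainePstAdicCompletion v 2 hv).algebra
          (Literature.NumberTheory.PAdicHodge.fontainePstAdicCompletion v 2 hv).𝔅 τ).Nodup) :
    ∃ 𝒰 : Literature.NumberTheory.Automorphic.BigHeckeGLn.TameLevel 2 ℚ 2, 𝒰.IsPadicallyAutomorphic ρ :=
  h 2 rfl ρ hres hsol hirr hodd hunr hdR

/-- **Stub — the line's trust base: Pan II classicality for `GL₂/ℚ`, every prime** (named fact
`Pan2022_proModularDeRhamClassical_GL2Q`, p145835: Pan arXiv:2209.06366 Thm 1.1.2 = 7.1.2 + Pan 2022-I Cor 6.3.6 +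
Paškūnas–Tung 2021 Thm 7.1).  XL printed theorem; discharging it is a literature debt, not this line's work. -/
theorem stub_Pan2022 : Literature.NumberTheory.Automorphic.Pan2022_proModularDeRhamClassical_GL2Q := by
  sorry

/-- **Stub (worker) — CLASSICALITY at `2` from the named fact — LANDED p148844** (rev 2: curried over `stub_Pan2022`; the body after
the first arrow is rev 1's registered signature verbatim).  For `ℓ = 2` and `ρ : Γ_ℚ → GL₂(ℚ̄₂)` residually
absolutely irreducible, irreducible, unramified a.e., de Rham at 2 with distinct labelled Hodge–Tate weights and
2-adically automorphic of some tame level, some Tate twist `ρ ⊗ ε₂^m` is attached to a newform away from `N·2`. -/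
theorem stub_classicality : Literature.NumberTheory.Automorphic.Pan2022_proModularDeRhamClassical_GL2Q → ∀ (ℓ : ℕ) [Fact ℓ.Prime], ℓ = 2 → ∀ (ρ : Literature.NumberTheory.GaloisRepresentations.FramedGaloisRep ℚ (PadicAlgCl ℓ) 2), ρ.IsResiduallyAbsIrreducible → ρ.toGaloisRep.IsIrreducible → (∀ᶠ v : IsDedekindDomain.HeightOneSpectrum (NumberField.RingOfIntegers ℚ) in Filter.cofinite, ρ.IsUnramifiedAt v) → (∀ (v : IsDedekindDomain.HeightOneSpectrum (NumberField.RingOfIntegers ℚ)) (hv : ((ℓ : ℕ) : NumberField.RingOfIntegers ℚ) ∈ v.asIdeal), (Literature.NumberTheory.PAdicHodge.fontainePstAdicCompletion v ℓ hv).IsDeRhamFramed (ρ.toLocal v) ∧ ∀ τ : v.adicCompletion ℚ →+* PadicAlgCl ℓ, Continuous τ → (ρ.labelledHodgeTateWeightsAt v (Literature.NumberTheory.PAdicHodge.fontainePstAdicCompletion v ℓ hv).algebra (Literature.NumberTheory.PAdicHodge.fontainePstAdicCompletion v ℓ hv).𝔅 τ).Nodup) → (∃ 𝒰 : Literature.NumberTheory.Automorphic.BigHeckeGLn.TameLevel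 2 ℚ ℓ, 𝒰.IsPadicallyAutomorphic ρ) → ∃ (χ : Field.absoluteGaloisGroup ℚ →ₜ* (PadicAlgCl ℓ)ˣ) (m : ℤ), (∀ σ, χ σ = Literature.NumberTheory.GaloisRepresentations.cyclotomicPadicAlgCl ℚ ℓ σ ^ m) ∧ ∃ (N : ℕ) (_ : NeZero N) (k : ℤ) (f : CuspForm (CongruenceSubgroup.Gamma1 N) k) (ιf : Literature.NumberTheory.EllipticCurves.ModularForms.coeffCharField f →+* PadicAlgCl ℓ), Literature.NumberTheory.EllipticCurves.ModularForms.IsNewform1 f ∧ Literature.NumberTheory.EllipticCurves.ModularForms.IsGaloisRepOfNewform1 f ιf {q | q ∣ N * ℓ} (Literature.NumberTheory.GaloisRepresentations.FramedRep.twist ρ χ) :=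
  -- LANDED (p148844): `Theorems/DyadicOddResidueDyadicDihedralFMClassicality.lean`
  Summit.Langlands.Langlands.Theorems.DyadicDihedralFM.stub_classicality

/-- **Stub (worker) — DICTIONARY — LANDED p145281: Tate-twist newform modularity ⇒ the crux's automorphic
conclusion, every prime `ℓ`.**  If some `ρ ⊗ ε_ℓ^m` is attached to a newform `f` away from `N ℓ`, then for every
`hcpt` and `ι : ℚ̄_ℓ ≃ ℂ` there is an `L`-algebraic cuspidal `π` of `GL₂(𝔸_ℚ)` (namely `π(f^τ) ⊗ |det|^{-m}`,
`τ = ι ∘ ι_f`) Satake–Frobenius compatible with `ρ` at almost all places — the proof of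
`Theorems.oddPrimesRegularFM_of_tateTwistModularity` verbatim with `ℓ` free. -/
theorem stub_dictionary : ∀ (ℓ : ℕ) [Fact ℓ.Prime] (ρ : Literature.NumberTheory.GaloisRepresentations.FramedGaloisRep ℚ (PadicAlgCl ℓ) 2), (∃ (χ : Field.absoluteGaloisGroup ℚ →ₜ* (PadicAlgCl ℓ)ˣ) (m : ℤ), (∀ σ, χ σ = Literature.NumberTheory.GaloisRepresentations.cyclotomicPadicAlgCl ℚ ℓ σ ^ m) ∧ ∃ (N : ℕ) (_ : NeZero N) (k : ℤ) (f : CuspForm (CongruenceSubgroup.Gamma1 N) k) (ιf : Literature.NumberTheory.EllipticCurves.ModularForms.coeffCharField f →+* PadicAlgCl ℓ), Literature.NumberTheory.EllipticCurves.ModularForms.IsNewform1 f ∧ Literature.NumberTheory.EllipticCurves.ModularForms.IsGaloisRepOfNewform1 f ιf {q | q ∣ N * ℓ} (Literature.NumberTheory.GaloisRepresentations.FramedRep.twist ρ χ)) → ∀ (hcpt : Literature.NumberTheory.Automorphic.isCompact_glFiniteIntegralLevel 2 ℚ) (ι : PadicAlgCl ℓ ≃+* ℂ), ∃ π : Literature.NumberTheory.Automorphic.CuspidalAutomorphicRepData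 2 ℚ hcpt, π.1.IsLAlgebraic ∧ ∀ᶠ v : IsDedekindDomain.HeightOneSpectrum (NumberField.RingOfIntegers ℚ) in Filter.cofinite, Summit.Langlands.SatakeFrobCompatibleAt ι π.1 ρ v :=
  -- LANDED (wave 1, p145281): `Theorems/DyadicOddResidueDyadicDihedralFMDictionary.lean`
  Summit.Langlands.Langlands.Theorems.DyadicDihedralFM.stub_dictionary

/-! ## 2. The composition: the stubs close the crux BY NAME (pure logic). -/

/-- The composition (rev 3): at `ℓ = 2`, case on the two printed cells — `CellThorne` (Thorne 2026 Thm D) and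
`CellAllen` (Allen 2014) go straight to the dictionary; off both cells the open core `stub_proModularity_core`
feeds Pan II classicality (`stub_classicality stub_Pan2022`) and then the dictionary.  Concludes the route decl BY
NAME. -/
theorem DyadicDihedralFM_of : DyadicDihedralFM := by
  intro ℓ _ hℓ ρ hres hsol hirr hodd hunr hdR hcpt ι
  subst hℓ
  by_cases hB : CellThorne 2 ρ
  · exact stub_dictionary 2 ρ (cellThorne_newform stub_Thorne2026 2 ρ hunr hirr hodd hB) hcpt ι
  by_cases hA : CellAllen ρ
  · exact stub_dictionary 2 ρ (cellAllen_newform stub_Allen2014 ρ hunr hodd hres hsol hA) hcpt ι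
  exact stub_dictionary 2 ρ
    (stub_classicality stub_Pan2022 2 rfl ρ hres hirr hunr hdR
      (stub_proModularity_core ρ hres hsol hirr hodd hunr hdR hB hA)) hcpt ι

/-! ## 3. For the planner: the WEAKER core also suffices (no pro-modularity, no Pan II)

If the open cell is attacked by any method that outputs classical modularity directly (as Allen and Thorne do), the
line needs only "core ⇒ Tate-twist newform".  `CoreNewform` is that statement (same domain as
`stub_proModularity_core`; conclusion = the input of `stub_dictionary`); it is implied by the registered core via
`stub_classicality stub_Pan2022` (`coreNewform_of_core`), and it closes the crux with the Thorne and Allen facts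
alone (`DyadicDihedralFM_of_coreNewform`).  Recommended object to promote if the planner re-lines the crux by cells. -/

/-- The open cell in MODULARITY form: off the two printed cells, some Tate twist of `ρ` is attached to a newform. -/
def CoreNewform : Prop :=
  ∀ (ρ : Literature.NumberTheory.GaloisRepresentations.FramedGaloisRep ℚ (PadicAlgCl 2) 2),
    ρ.IsResiduallyAbsIrreducible → IsSolvable ρ.residualRep.range → ρ.toGaloisRep.IsIrreducible → ρ.IsOdd →
    (∀ᶠ v : IsDedekindDomain.HeightOneSpectrum (NumberField.RingOfIntegers ℚ) in Filter.cofinite,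
      ρ.IsUnramifiedAt v) →
    (∀ (v : IsDedekindDomain.HeightOneSpectrum (NumberField.RingOfIntegers ℚ))
      (hv : ((2 : ℕ) : NumberField.RingOfIntegers ℚ) ∈ v.asIdeal),
      (Literature.NumberTheory.PAdicHodge.fontainePstAdicCompletion v 2 hv).IsDeRhamFramed (ρ.toLocal v) ∧
      ∀ τ : v.adicCompletion ℚ →+* PadicAlgCl 2, Continuous τ →
        (ρ.labelledHodgeTateWeightsAt v (Literature.NumberTheory.PAdicHodge.fontainePstAdicCompletion v 2 hv).algebra
          (Literature.NumberTheory.PAdicHodge.fontainePstAdicCompletion v 2 hv).𝔅 τ).Nodup) →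
    ¬ CellThorne 2 ρ → ¬ CellAllen ρ →
    ∃ (χ : Field.absoluteGaloisGroup ℚ →ₜ* (PadicAlgCl 2)ˣ) (m : ℤ),
      (∀ σ, χ σ = Literature.NumberTheory.GaloisRepresentations.cyclotomicPadicAlgCl ℚ 2 σ ^ m) ∧
      ∃ (N : ℕ) (_ : NeZero N) (k : ℤ) (f : CuspForm (CongruenceSubgroup.Gamma1 N) k)
        (ιf : Literature.NumberTheory.EllipticCurves.ModularForms.coeffCharField f →+* PadicAlgCl 2),
        Literature.NumberTheory.EllipticCurves.ModularForms.IsNewform1 f ∧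
        Literature.NumberTheory.EllipticCurves.ModularForms.IsGaloisRepOfNewform1 f ιf {q | q ∣ N * 2}
          (Literature.NumberTheory.GaloisRepresentations.FramedRep.twist ρ χ)

/-- The registered core (pro-modularity) with Pan II gives the modularity form of the core. -/
theorem coreNewform_of_core : CoreNewform := by
  intro ρ hres hsol hirr hodd hunr hdR hB hA
  exact stub_classicality stub_Pan2022 2 rfl ρ hres hirr hunr hdR
    (stub_proModularity_core ρ hres hsol hirr hodd hunr hdR hB hA)

/-- The crux from the modularity form of the core and the Thorne / Allen facts only (Pan II not needed). -/
theorem DyadicDihedralFM_of_coreNewform (hcore : CoreNewform)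
    (hT : Literature.NumberTheory.Automorphic.Thorne2026_fontaineMazurGL2_potCrystallineOrdinary)
    (hA' : Literature.NumberTheory.Automorphic.Allen2014_modularity_nearlyOrdinaryDihedral_Q) :
    DyadicDihedralFM := by
  intro ℓ _ hℓ ρ hres hsol hirr hodd hunr hdR hcpt ι
  subst hℓ
  by_cases hB : CellThorne 2 ρ
  · exact stub_dictionary 2 ρ (cellThorne_newform hT 2 ρ hunr hirr hodd hB) hcpt ι
  by_cases hA : CellAllen ρ
  · exact stub_dictionary 2 ρ (cellAllen_newform hA' ρ hunr hodd hres hsol hA) hcpt ι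
  exact stub_dictionary 2 ρ (hcore ρ hres hsol hirr hodd hunr hdR hB hA) hcpt ι

end

end Summit.Langlands.Langlands.Cruxes.DyadicDihedralFM.Sketch
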